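import Summits.BirchSwinnertonDyer.BirchSwinnertonDyer.Theorems.Rank2ObservatoryCubicFieldM235291
import HarnessLib

/-!
# BirchSwinnertonDyer — rank ≥ 2 observatory: class number one of the cubic field of `-527 - 122 * X + X ^ 3` (`Δ = -235291`) — certificates at the primes 131, 137

HONEST FRAMING: per-curve certified theorems and census instruments; no claim on BSD in rank ≥ 2.

Companion of the per-FIELD file `Rank2ObservatoryCubicFieldM235291` of the KERNEL-2DESC instrument (design
`b2b-bsdr2-cert-3/KERNEL-2DESC.md` §9e–§9g): the degree-one prime-element certificates at the primes 131, 137 (part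
b). Split off for file size; generated by the same generator from the same checked data.
Sorry-free; axioms `propext`, `Classical.choice`, `Quot.sound`.
[cite: Marcus2018, Ch. 3 Thm. 27, Ch. 5 Cor. 2 of Thm. 37]
-/

-- single-conjunct summit: `Summit.BirchSwinnertonDyer.BirchSwinnertonDyer.…` repeats the name by design
set_option linter.dupNamespace false

noncomputable section

open scoped Classical NumberField

open Literature.NumberTheory.NumberFields Polynomial Module NumberField

namespace Summit.BirchSwinnertonDyer.BirchSwinnertonDyer.Rank2Observatory.TwoDescCubic

namespace FieldM235291

/-! ## Class number one -/

/-- Certificate at `131`: every ring map `ψ : 𝓞 K → ℤ/131` kills a prime element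
(`α ↦ 71`: `-148308228 - 12873434 * α + 1916055 * α ^ 2` (norm `131`)). [cite: Marcus2018, Ch. 3, Thm. 27] -/
theorem cert131 (ψ : 𝓞 (CubicField 0 (-122) (-527)) →+* ZMod 131) : ∃ e : 𝓞 (CubicField 0 (-122) (-527)), ψ e = 0 ∧ Prime e := by
  refine cert_of_cases aeval_α ψ (fun t ht hF => ?_)
  have hroots : ∀ t : ZMod 131,
      t ^ 3 + ((0 : ℤ) : ZMod 131) * t ^ 2 + (((-122) : ℤ) : ZMod 131) * t + (((-527) : ℤ) : ZMod 131) = 0 → t = 71 := by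
    decide +kernel
  obtain rfl := hroots t hF
  exact ⟨lin aeval_α (-148308228) (-12873434) 1916055, by simp only [lin, map_add, map_mul, map_pow, map_intCast, ht]; decide,
      lin_prime_of_prime irreducible aeval_α finrank_eq (-148308228) (-12873434) 1916055 (n := 131)
        (by norm_num [MonicCubic.normForm]) (by norm_num)⟩

/-- Certificate at `137`: every ring map `ψ : 𝓞 K → ℤ/137` kills a prime element
(`α ↦ 31`: `896698 + 68421 * α - 10848 * α ^ 2` (norm `-137`)). [cite: Marcus2018, Ch. 3, Thm. 27] -/
theorem cert137 (ψ : 𝓞 (CubicField 0 (-122) (-527)) →+* ZMod 137) : ∃ e : 𝓞 (CubicField 0 (-122) (-527)), ψ e = 0 ∧ Prime e := by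
  refine cert_of_cases aeval_α ψ (fun t ht hF => ?_)
  have hroots : ∀ t : ZMod 137,
      t ^ 3 + ((0 : ℤ) : ZMod 137) * t ^ 2 + (((-122) : ℤ) : ZMod 137) * t + (((-527) : ℤ) : ZMod 137) = 0 → t = 31 := by
    decide +kernel
  obtain rfl := hroots t hF
  exact ⟨lin aeval_α 896698 68421 (-10848), by simp only [lin, map_add, map_mul, map_pow, map_intCast, ht]; decide,
      lin_prime_of_prime irreducible aeval_α finrank_eq 896698 68421 (-10848) (n := (-137))
        (by norm_num [MonicCubic.normForm]) (by norm_num)⟩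

end FieldM235291

end Summit.BirchSwinnertonDyer.BirchSwinnertonDyer.Rank2Observatory.TwoDescCubic

end
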